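import Literature.IUT.HodgeTheaters.TemperedCoveringsCor23viHatIncidenceReduction
import HarnessLib

/-!
# [IUTchI] Cor. 2.3 (vi) at the genuine 𝔛-datum: the CUSP-ONLY (open-edge) form of the pro-`Σ̂` incidence binder
# (row «COR23VI-HATH-PROSIGMA», by-name target for the L3 supplier row «NODNON-LEM17@PSC»)

S. Mochizuki, *Inter-universal Teichmüller theory I: construction of Hodge theaters*, kurims manuscript (May 2020),
§2, Corollary 2.3 (vi) p. 48 l. 6–16, proof p. 49 l. 62–64 [cite: Mochizuki2012, Cor 2.3(vi) pp.48-49] (D-0012 claim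
key; series status DISPUTED; nothing of the series is asserted here); S. Mochizuki, *Semi-graphs of anabelioids*,
Publ. RIMS **42** (2006), §1 p. 11 (open edges: a branch abutting to no vertex), Ex. 3.10 p. 44 (the cusps of `X_K`
↔ the open edges of `G^c`), §6 p. 71 (`I_x`) [cite: MochizukiSemiAnbd2006, Ex 3.10 p.44]; Y. Hoshi, S. Mochizuki,
[NodNon] Lem. 1.7 p. 17, [CbTpI] Prop. 2.9 (i) p. 44 (the published route, abc-iut-w4-d070's presearch).

PROOF-ONLY sequel (abc-iut cell, seat abc-iut-w4-d059 gen 8; cone row `IUTchI:Cor2.3(vi)`; no definition, no instance,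
no new `Prop` fact) of `TemperedCoveringsCor23viHatIncidenceReduction.lean` (p492945: `hhatH` ⟸ `hF` ∧ `hdict`).
The node only ever feeds CUSP edges into `hF`, so the L3 supplier may prove the WEAKER statement `hFcusp` = `hF`
restricted to OPEN edges `e` (`∃ b₀, edgeOf b₀ = e ∧ abuts b₀ = none`); it is consumed here together with the cusp ↦
OPEN-edge dictionary `hdictO` («`J_x` is an edge-like subgroup of an edge `e_x` one of whose branches abuts to `vtx x`
while every OTHER branch abuts to no vertex»), which implies p492945's `hdict` (`cuspEdgeDict_of_cuspOpenEdgeDict`) and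
makes `e_x` open (`exists_branch_abuts_none_of_cuspOpenEdgeDict`, via `SemiGraph.two_branches`).  Headlines:
`hhatH_of_hatCuspIncidence_of_cuspOpenEdgeDict` and the closers `…_of_mem_decompSubgroups_of_hatCuspIncidence` /
`…_of_piData_of_hatCuspIncidence`.  BINDER CENSUS: LAW 0 at the datum level · FACT-CANDIDATE 1 (`hFcusp`, the open-edge
case of GAP row G-w4d059-g8-1) · ORIGIN 1 (`hdictO`).  Model-RELATIVE; typed ≠ discharged for the [IUTchI] claim keys;
a displayed hypothesis is not a theorem; nothing here bears on [IUTchIII] Cor. 3.12 or asserts that abc is proved or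
refuted.
-/

noncomputable section

namespace Literature.IUT.HodgeTheaters

open _root_.Topology
open scoped Pointwise
open Literature.AnabelianGeometry.SemiGraphs
open Literature.AnabelianGeometry.SemiGraphs.ProfiniteSemiGraph

namespace StableCurveTemperedData

section CuspOnly

variable {p : ℕ} [Fact p.Prime] (X : TemperedCurve p) (d : X.GroupLevelData)
  (S : SpecialFibreData (X.toTemperedArithmeticGroup d)) (h36 : S.Gc.Prop36Hypotheses)
  (Sigma SigmaHat : Set ℕ) (hsub : Sigma ⊆ SigmaHat) (hne : Sigma.Nonempty)
  (hprime : ∀ q ∈ SigmaHat, q.Prime) (hp : p ∉ Sigma)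
  (TpH : Subgroup S.chart.G)

/-- **The open-edge dictionary implies the cusp-edge dictionary**: if every branch of `e_x` other than the one abutting
to `vtx x` abuts to no vertex, then every abutting branch of `e_x` abuts to `vtx x`.
[cite: MochizukiSemiAnbd2006, Ex 3.10 p.44] -/
theorem cuspEdgeDict_of_cuspOpenEdgeDict (vtx : {x : X.Pt // X.IsCusp x} → S.Gc.graph.Vertex)
    (hdictO : ∀ x : {x : X.Pt // X.IsCusp x}, ∃ b : S.Gc.graph.Branch, S.Gc.graph.abuts b = some (vtx x) ∧
      (∀ b' : S.Gc.graph.Branch, S.Gc.graph.edgeOf b' = S.Gc.graph.edgeOf b → b' ≠ b → S.Gc.graph.abuts b' = none) ∧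
      ((X.inertia x.1).subgroupOf (X.toTemperedArithmeticGroup d).delta).map S.admissible.toMonoidHom ∈
        edgeLikeSubgroups S.chart (S.Gc.graph.edgeOf b)) :
    ∀ x : {x : X.Pt // X.IsCusp x}, ∃ b : S.Gc.graph.Branch, S.Gc.graph.abuts b = some (vtx x) ∧
      (∀ b' : S.Gc.graph.Branch, S.Gc.graph.edgeOf b' = S.Gc.graph.edgeOf b →
        ∀ w : S.Gc.graph.Vertex, S.Gc.graph.abuts b' = some w → w = vtx x) ∧
      ((X.inertia x.1).subgroupOf (X.toTemperedArithmeticGroup d).delta).map S.admissible.toMonoidHom ∈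
        edgeLikeSubgroups S.chart (S.Gc.graph.edgeOf b) := by
  intro x
  obtain ⟨b, hb, hother, hJ⟩ := hdictO x
  refine ⟨b, hb, fun b' hb'e w hb'w => ?_, hJ⟩
  by_cases hb'b : b' = b
  · subst hb'b
    rw [hb] at hb'w
    exact (Option.some_injective _ hb'w).symm
  · rw [hother b' hb'e hb'b] at hb'w
    exact absurd hb'w.symm (Option.some_ne_none w)

/-- **An edge carrying the open-edge dictionary IS open**: it has a branch abutting to no vertex (every edge has
exactly two branches, `SemiGraph.two_branches`). [cite: MochizukiSemiAnbd2006, §1 p.11] -/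
theorem exists_branch_abuts_none_of_cuspOpenEdgeDict {b : S.Gc.graph.Branch}
    (hother : ∀ b' : S.Gc.graph.Branch, S.Gc.graph.edgeOf b' = S.Gc.graph.edgeOf b → b' ≠ b →
      S.Gc.graph.abuts b' = none) :
    ∃ b₀ : S.Gc.graph.Branch, S.Gc.graph.edgeOf b₀ = S.Gc.graph.edgeOf b ∧ S.Gc.graph.abuts b₀ = none := by
  obtain ⟨b₁, b₂, hne12, h1, h2, -⟩ := S.Gc.graph.two_branches (S.Gc.graph.edgeOf b)
  by_cases hb1 : b₁ = b
  · subst hb1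
    exact ⟨b₂, h2, hother b₂ h2 (fun h => hne12 h.symm)⟩
  · exact ⟨b₁, h1, hother b₁ h1 hb1⟩

/-- **`hhatH` (G-w4d070-g11-2) from the CUSP-ONLY incidence statement `hFcusp`** (the pro-`Σ̂` edge–subgraph incidence
restricted to OPEN edges `e` — «an edge-like subgroup of an open edge `e` lying in a `Π̂_𝔾`-conjugate of `Π̂_ℍ` forces `e`
to abut to a vertex of `ℍ`», [NodNon] Lem. 1.7 + [CbTpI] Prop. 2.9 (i) for cusps) **and the open-edge dictionary
`hdictO`**. [cite: Mochizuki2012, Cor 2.3(vi) pp.48-49] [claim: Mochizuki2012, status: disputed] -/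
theorem hhatH_of_hatCuspIncidence_of_cuspOpenEdgeDict {H : S.Gc.graph.Subgraph}
    (vtx : {x : X.Pt // X.IsCusp x} → S.Gc.graph.Vertex)
    (hFcusp : ∀ (e : S.Gc.graph.Edge),
      (∃ b₀ : S.Gc.graph.Branch, S.Gc.graph.edgeOf b₀ = e ∧ S.Gc.graph.abuts b₀ = none) →
      ∀ L ∈ edgeLikeSubgroups S.chart e,
      ∀ g : (TemperedGraphGroupData.exists_completion_of_prop36 S.Gc h36 S.chart).choose,
        L.map (TemperedGraphGroupData.exists_completion_of_prop36 S.Gc h36 S.chart).choose_spec.choose.toMonoidHom ≤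
          MulAut.conj g • (TpH.map (TemperedGraphGroupData.exists_completion_of_prop36 S.Gc h36
            S.chart).choose_spec.choose.toMonoidHom).topologicalClosure →
        ∃ b : S.Gc.graph.Branch, S.Gc.graph.edgeOf b = e ∧ ∃ w ∈ H.verts, S.Gc.graph.abuts b = some w)
    (hdictO : ∀ x : {x : X.Pt // X.IsCusp x}, ∃ b : S.Gc.graph.Branch, S.Gc.graph.abuts b = some (vtx x) ∧
      (∀ b' : S.Gc.graph.Branch, S.Gc.graph.edgeOf b' = S.Gc.graph.edgeOf b → b' ≠ b → S.Gc.graph.abuts b' = none) ∧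
      ((X.inertia x.1).subgroupOf (X.toTemperedArithmeticGroup d).delta).map S.admissible.toMonoidHom ∈
        edgeLikeSubgroups S.chart (S.Gc.graph.edgeOf b)) :
    ∀ x : {x : X.Pt // X.IsCusp x},
      (∃ g : (TemperedGraphGroupData.exists_completion_of_prop36 S.Gc h36 S.chart).choose,
        (((X.inertia x.1).subgroupOf (X.toTemperedArithmeticGroup d).delta).map S.admissible.toMonoidHom).map
            (TemperedGraphGroupData.exists_completion_of_prop36 S.Gc h36 S.chart).choose_spec.choose.toMonoidHom ≤
          MulAut.conj g • (TpH.map (TemperedGraphGroupData.exists_completion_of_prop36 S.Gc h36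
            S.chart).choose_spec.choose.toMonoidHom).topologicalClosure) →
      vtx x ∈ H.verts := by
  intro x hx
  obtain ⟨g, hg⟩ := hx
  obtain ⟨b, hb, hother, hJ⟩ := hdictO x
  obtain ⟨b', hb'e, w, hwH, hb'w⟩ :=
    hFcusp (S.Gc.graph.edgeOf b) (exists_branch_abuts_none_of_cuspOpenEdgeDict X d S hother) _ hJ g hg
  by_cases hb'b : b' = b
  · subst hb'b
    rw [hb] at hb'w
    rw [Option.some_injective _ hb'w]
    exact hwH
  · rw [hother b' hb'e hb'b] at hb'w
    exact absurd hb'w.symm (Option.some_ne_none w)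

/-- **Row `IUTchI:Cor2.3(vi)` at the genuine datum, GENERAL connected `ℍ` with a vertex, every
`Π^tp_ℍ := TpH ∈ decompSubgroups S.chart ℍ` — binders {`hFcusp` (incidence for OPEN edges only), `hdictO` (cusp ↦ open
edge)}.**  FQ type per the gate rule. [cite: Mochizuki2012, Cor 2.3(vi) pp.48-49] [claim: Mochizuki2012, status: disputed] -/
theorem cor23vi_ofSpecialFibre_closureH_of_mem_decompSubgroups_of_hatCuspIncidence {H : S.Gc.graph.Subgraph}
    (hTpH : TpH ∈ S.chart.decompSubgroups H) (hconn : (S.Gc.restrict H).IsConnected)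
    (hv : (S.Gc.restrict H).HasVertex)
    (vtx : {x : X.Pt // X.IsCusp x} → S.Gc.graph.Vertex)
    (hFcusp : ∀ (e : S.Gc.graph.Edge),
      (∃ b₀ : S.Gc.graph.Branch, S.Gc.graph.edgeOf b₀ = e ∧ S.Gc.graph.abuts b₀ = none) →
      ∀ L ∈ edgeLikeSubgroups S.chart e,
      ∀ g : (TemperedGraphGroupData.exists_completion_of_prop36 S.Gc h36 S.chart).choose,
        L.map (TemperedGraphGroupData.exists_completion_of_prop36 S.Gc h36 S.chart).choose_spec.choose.toMonoidHom ≤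
          MulAut.conj g • (TpH.map (TemperedGraphGroupData.exists_completion_of_prop36 S.Gc h36
            S.chart).choose_spec.choose.toMonoidHom).topologicalClosure →
        ∃ b : S.Gc.graph.Branch, S.Gc.graph.edgeOf b = e ∧ ∃ w ∈ H.verts, S.Gc.graph.abuts b = some w)
    (hdictO : ∀ x : {x : X.Pt // X.IsCusp x}, ∃ b : S.Gc.graph.Branch, S.Gc.graph.abuts b = some (vtx x) ∧
      (∀ b' : S.Gc.graph.Branch, S.Gc.graph.edgeOf b' = S.Gc.graph.edgeOf b → b' ≠ b → S.Gc.graph.abuts b' = none) ∧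
      ((X.inertia x.1).subgroupOf (X.toTemperedArithmeticGroup d).delta).map S.admissible.toMonoidHom ∈
        edgeLikeSubgroups S.chart (S.Gc.graph.edgeOf b)) :
    Literature.IUT.HodgeTheaters.StableCurveTemperedData.Cor23vi
        (ofSpecialFibre X d S h36 Sigma SigmaHat hsub hne hprime hp TpH ((TpH.map
          (TemperedGraphGroupData.exists_completion_of_prop36 S.Gc h36 S.chart).choose_spec.choose.toMonoidHom
          ).topologicalClosure) (Subgroup.le_topologicalClosure _) (fun x => vtx x ∈ H.verts)) :=
  cor23vi_ofSpecialFibre_closureH_of_mem_decompSubgroups_of_cuspLaws X d S h36 Sigma SigmaHat hsub hne hprime hp TpH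
    hTpH hconn hv vtx (hcusp_of_cuspEdgeDict X d S h36 vtx (cuspEdgeDict_of_cuspOpenEdgeDict X d S vtx hdictO))
    (hhatH_of_hatCuspIncidence_of_cuspOpenEdgeDict X d S h36 TpH vtx hFcusp hdictO)

variable {T : SpecialFibreTower X.DeltaTemp} (P : SpecialFibreTower.PiData X d S T)

/-- **Row `IUTchI:Cor2.3(vi)` over the origin record `P`** (`ℍ := P.H`, `TpH ∈ decompSubgroups S.chart P.H`, print's cusp
predicate from (P3), any level `i`) — binders {`hFcusp`, `hdictO`}.  FQ type per the gate rule.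
[cite: Mochizuki2012, Cor 2.3(vi) pp.48-49] [claim: Mochizuki2012, status: disputed] -/
theorem cor23vi_ofSpecialFibre_closureH_of_piData_of_hatCuspIncidence (i : ℕ)
    (hTpH : TpH ∈ S.chart.decompSubgroups P.H)
    (hFcusp : ∀ (e : S.Gc.graph.Edge),
      (∃ b₀ : S.Gc.graph.Branch, S.Gc.graph.edgeOf b₀ = e ∧ S.Gc.graph.abuts b₀ = none) →
      ∀ L ∈ edgeLikeSubgroups S.chart e,
      ∀ g : (TemperedGraphGroupData.exists_completion_of_prop36 S.Gc h36 S.chart).choose,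
        L.map (TemperedGraphGroupData.exists_completion_of_prop36 S.Gc h36 S.chart).choose_spec.choose.toMonoidHom ≤
          MulAut.conj g • (TpH.map (TemperedGraphGroupData.exists_completion_of_prop36 S.Gc h36
            S.chart).choose_spec.choose.toMonoidHom).topologicalClosure →
        ∃ b : S.Gc.graph.Branch, S.Gc.graph.edgeOf b = e ∧ ∃ w ∈ P.H.verts, S.Gc.graph.abuts b = some w)
    (hdictO : ∀ x : {x : X.Pt // X.IsCusp x}, ∃ b : S.Gc.graph.Branch,
      S.Gc.graph.abuts b = some ((P.proj i).vertexMap (P.vtxOfCusp i x)) ∧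
      (∀ b' : S.Gc.graph.Branch, S.Gc.graph.edgeOf b' = S.Gc.graph.edgeOf b → b' ≠ b → S.Gc.graph.abuts b' = none) ∧
      ((X.inertia x.1).subgroupOf (X.toTemperedArithmeticGroup d).delta).map S.admissible.toMonoidHom ∈
        edgeLikeSubgroups S.chart (S.Gc.graph.edgeOf b)) :
    Literature.IUT.HodgeTheaters.StableCurveTemperedData.Cor23vi
        (ofSpecialFibre X d S h36 Sigma SigmaHat hsub hne hprime hp TpH ((TpH.map
          (TemperedGraphGroupData.exists_completion_of_prop36 S.Gc h36 S.chart).choose_spec.choose.toMonoidHom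
          ).topologicalClosure) (Subgroup.le_topologicalClosure _)
          (fun x => (P.proj i).vertexMap (P.vtxOfCusp i x) ∈ P.H.verts)) :=
  cor23vi_ofSpecialFibre_closureH_of_mem_decompSubgroups_of_hatCuspIncidence X d S h36 Sigma SigmaHat hsub hne hprime hp
    TpH hTpH P.H_connected ⟨⟨P.baseVertex, P.baseVertex_mem⟩⟩ (fun x => (P.proj i).vertexMap (P.vtxOfCusp i x))
    hFcusp hdictO

end CuspOnly

end StableCurveTemperedData

end Literature.IUT.HodgeTheaters

end
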